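import Summits.BirchSwinnertonDyer.BirchSwinnertonDyer.Theorems.GenusKolyvaginAtTwoGenusPrimitiveSupplyAtTwoArchimedeanDescAdmissible
import Summits.BirchSwinnertonDyer.BirchSwinnertonDyer.Theorems.GenusKolyvaginAtTwoGenusPrimitiveSupplyAtTwoSupplyDEF1OfParity
import HarnessLib

/-!
# Route `GenusKolyvaginAtTwo`, crux #2 `GenusPrimitiveSupplyAtTwo` (stmt-BirchSwinnertonDyer-22136):
# SUPPLY″ with T-A DISCHARGED — the DEF = 1 Sel₂-minimal twin on `{Δ > 0, #Sel₂ = 1}` modulo {PT, Tate χ, Kramer parity} only,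
# and the whole-habitat supply modulo {PT, Tate χ, Kramer parity} (+ T-V on row 1 of `Δ > 0`)

Width seat `bsd-line-gk2-p5` g9 (cell `bsd-f1-sign2`, SUPPLY lineage, «UP general-K lane»), file 26 of the series (sequel of
`…ArchimedeanDescAdmissible.lean` and of g9's `…SupplyDEF1OfParity.lean` p630984). THEOREMS ONLY (no definition, no named fact, no `sorry`,
no local instance); helper `--supports stmt-BirchSwinnertonDyer-22136`; no item is closed; BSD is not proved by any of this.

WHAT. g7's `supply_DEF1_posDisc_of_shift` / `supply_DEF1_posDisc` and g9's `supply_DEF1_minimalTwin_of_parity` /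
`supply_DEF1_minimalTwin_habitat_of_parity` took T-A `F1Sign2.AdmissibleTwistSelmerShiftAtTwo` BY NAME for the `{Δ > 0, #Sel₂(W) = 1}` rows.
File 25's `GenusKolyArch.admissibleTwistSelmerShift_habitat_of_parity` proves T-A's conclusion on the habitat (`ρ̄_{W,2}` onto) modulo
{PT, Tate χ, Kramer parity}; this file re-runs the supply with it:

* §64 `supply_DEF1_posDisc_of_shiftAt` — g7's `supply_DEF1_posDisc_of_shift` with the named fact replaced by the PER-CURVE dichotomy
  `hshift : ∀ d, DescAdmissible W d → 2·#Sel₂(W^{(d)}) = #Sel₂(W) ∨ #Sel₂(W^{(d)}) = 2·#Sel₂(W)` (proof verbatim otherwise);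
* §65 `supply_DEF1_posDisc_of_parity` — g7's `supply_DEF1_posDisc` on the habitat mod {PT, Tate χ, Kramer parity}: `Δ_W > 0`, `ρ̄₂` onto,
  `#Sel₂(W) = 1` ⟹ beyond every bound a silent admissible prime `ℓ` with the DEF = 1 field `ℚ(√−ℓ)` (every K-clause of crux 22136, `2`
  split, `E(ℚ_ℓ)[2] = 0`) and a globally minimal twin `Wd ≅ W^{(−ℓ)}` with `#Sel₂(Wd) = 2`;
* §66 `supply_DEF1_minimalTwin_of_parity'`, `supply_DEF1_minimalTwin_habitat_of_parity'` — g9's statements VERBATIM with the hypothesis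
  `(hA : AdmissibleTwistSelmerShiftAtTwo)` REMOVED: SUPPLY″ on the whole habitat `{ρ̄₂ onto, rank 0, #Sel₂ ∈ {1,4}}` modulo
  {PT (Milne I 4.10), Tate χ (Milne I 2.8), Kramer parity (Mazur–Rubin Thm. 2.7)} and, on the single row `{Δ > 0, #Sel₂ = 4}`, T-V
  `F1Sign2.StrictShaPropagationAtTwo` with `¬ DescentSignNeg W`.

References: [MazurRubin2010] Thm. 2.7, Lemma 2.9, Prop. 3.3, Cor. 3.4 (i); [Kramer1981] §2 Prop. 6, Thm. 1; [GrossLMS1991] §1 (p. 235);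
[MilneADT2006] I Thm. 2.8, 2.13, 4.10.
-/

set_option linter.dupNamespace false -- tree convention: `Summit.BirchSwinnertonDyer.BirchSwinnertonDyer.Theorems` (summit = sub-problem)
set_option autoImplicit false

noncomputable section

open scoped Classical

open NumberField WeierstrassCurve
open Literature.NumberTheory.EllipticCurves Literature.NumberTheory.QuadraticFields
open Literature.NumberTheory.GaloisRepresentations Literature.NumberTheory.GaloisCohomology Literature.NumberTheory
open Summit.BirchSwinnertonDyer.Rank1Residual.F1Sign2

namespace Summit.BirchSwinnertonDyer.BirchSwinnertonDyer.Theorems.GenusKolyTwin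

open Summit.BirchSwinnertonDyer.BirchSwinnertonDyer.Theorems.GenusKolyTwistingPrime (supply_DEF1_minimalTwin_rowOne_of_duality)
open Summit.BirchSwinnertonDyer.BirchSwinnertonDyer.Theorems.GenusKolyArch (admissibleTwistSelmerShift_habitat_of_parity)

variable (W : WeierstrassCurve ℚ) [W.IsElliptic] [W.IsGloballyMinimal]

/-! ## §64 g7's `supply_DEF1_posDisc_of_shift` with the per-curve dichotomy -/

/-- **SUPPLY″-Selmer on `{Δ_W > 0, #Sel₂(W) = 1}` from the PER-CURVE T-A dichotomy** (g7's `supply_DEF1_posDisc_of_shift` with the named fact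
`AdmissibleTwistSelmerShiftAtTwo` replaced by its instance at `W`): `ℓ ≡ 7 (8)`, `ℓ ≡ −1 (p ∣ N_W odd)` SILENT ⟹ `K = ℚ(√−ℓ)` has every
K-clause of crux 22136, `2` split, `E(ℚ_ℓ)[2] = 0`, and a GLOBALLY MINIMAL twin `Wd ≅ W^{(−ℓ)}` with `#Sel₂(Wd) = 2`.
[cite: Kramer1981, Prop. 6] [cite: MazurRubin2010, Lemma 2.10, Prop. 3.3] -/
theorem supply_DEF1_posDisc_of_shiftAt
    (hshift : ∀ d : ℤ, DescAdmissible W d →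
      2 * twistSelmerTwoCard W d = selmerTwoCard W ∨ twistSelmerTwoCard W d = 2 * selmerTwoCard W)
    (h1 : Nat.card (W.selmerGroup 2) = 1) {ℓ : ℕ} (hℓ : ℓ.Prime) (hℓ8 : ℓ % 8 = 7)
    (hℓN : ∀ p : ℕ, p.Prime → p ∣ W.conductorNorm ℤ → p ≠ 2 → (ℓ : ZMod p) = -1)
    (hsilent : ∀ x : ZMod ℓ, 4 * x ^ 3 + ((integralModelInt W).b₂ : ZMod ℓ) * x ^ 2 +
        2 * ((integralModelInt W).b₄ : ZMod ℓ) * x + ((integralModelInt W).b₆ : ZMod ℓ) ≠ 0) :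
    ∃ (K : Type) (_ : Field K) (_ : NumberField K), IsImaginaryQuadratic K ∧ discr K = -(ℓ : ℤ) ∧ Odd (discr K) ∧
      discr K ≠ -3 ∧ SatisfiesHeegnerHypothesis (W.conductorNorm ℤ) K ∧
      ¬ IsSquare ((discr K : ℚ) * -|W.Δ|) ∧ ¬ IsSquare ((discr K : ℚ) * (-(2 * |W.Δ|))) ∧
      ((Ideal.span {(2 : ℤ)}).primesOver (𝓞 K)).ncard = 2 ∧
      (∀ [Fact ℓ.Prime], ∀ Q : (W.baseChange ℚ_[ℓ]).toAffine.Point, 2 • Q = 0 → Q = 0) ∧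
      ∃ (Wd : WeierstrassCurve ℚ) (_ : Wd.IsElliptic) (_ : Wd.IsGloballyMinimal),
        (∃ C : VariableChange ℚ, C • W.quadraticTwist (discr K : ℚ) = Wd) ∧ Nat.card (Wd.selmerGroup 2) = 2 := by
  obtain ⟨hDA, hloc, K, _, _, hK, hd, hodd, hd3, hH, h2K, hsq1, hsq2⟩ :=
    exists_silent_heegnerField_of_prime W hℓ hℓ8 hℓN hsilent
  have htwist : twistSelmerTwoCard W (-(ℓ : ℤ)) = 2 := by
    rcases hshift (-(ℓ : ℤ)) hDA with h | h
    · rw [selmerTwoCard, h1] at h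
      omega
    · rw [h, selmerTwoCard, h1]
  have hd0 : ((discr K : ℤ) : ℚ) ≠ 0 := by exact_mod_cast NumberField.discr_ne_zero K
  haveI := W.isElliptic_quadraticTwist hd0
  obtain ⟨C, hC⟩ := hasGlobalMinimalModel_rat_holds (W.quadraticTwist ((discr K : ℤ) : ℚ))
  haveI := hC
  refine ⟨K, inferInstance, inferInstance, hK, hd, hodd, hd3, hH, hsq1, hsq2, h2K, hloc,
    C • W.quadraticTwist ((discr K : ℤ) : ℚ), inferInstance, hC, ⟨C, rfl⟩, ?_⟩
  rw [natCard_selmerGroup_model_eq_twistSelmerTwoCard W (NumberField.discr_ne_zero K) _ ⟨C, rfl⟩, hd, htwist]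

/-! ## §65 The `{Δ > 0, #Sel₂ = 1}` supply on the habitat, modulo {PT, Tate χ, Kramer parity} -/

/-- **SUPPLY″ on `{Δ_W > 0, #Sel₂(W) = 1}` with T-A DISCHARGED** (g7's `supply_DEF1_posDisc`, the named fact replaced by file 25's
`admissibleTwistSelmerShift_habitat_of_parity`): for `W/ℚ` globally minimal elliptic with `ρ̄_{W,2}` onto, `Δ_W > 0`, `#Sel₂(W) = 1`, beyond
every bound a SILENT admissible prime `ℓ ≡ 7 (8)` (Čebotarev, PROVED) with the DEF = 1 field `ℚ(√−ℓ)` and a globally minimal twin with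
`#Sel₂ = 2`, CONDITIONAL on `hPT`, `hEP`, `hKP` only. [cite: MazurRubin2010, Thm. 2.7, Lemma 2.9, Prop. 3.3, Cor. 3.4 (i)] [cite: Kramer1981, §2 Prop. 6] -/
theorem supply_DEF1_posDisc_of_parity (hPT : poitouTate_selmerStructure_duality_real ℚ)
    (hEP : ∀ v : IsDedekindDomain.HeightOneSpectrum (𝓞 ℚ), localEulerPoincareCharacteristic (v.adicCompletion ℚ))
    (hKP : MazurRubin2010.kramerParity ℚ) (hΔ : 0 < W.Δ)
    (hsurj : W.HasSurjectiveModNGaloisRep 2) (h1 : Nat.card (W.selmerGroup 2) = 1) (b : ℕ) :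
    ∃ ℓ : ℕ, b < ℓ ∧ ℓ.Prime ∧
      (∀ x : ZMod ℓ, 4 * x ^ 3 + ((integralModelInt W).b₂ : ZMod ℓ) * x ^ 2 +
        2 * ((integralModelInt W).b₄ : ZMod ℓ) * x + ((integralModelInt W).b₆ : ZMod ℓ) ≠ 0) ∧
      ∃ (K : Type) (_ : Field K) (_ : NumberField K), IsImaginaryQuadratic K ∧ discr K = -(ℓ : ℤ) ∧ Odd (discr K) ∧
        discr K ≠ -3 ∧ SatisfiesHeegnerHypothesis (W.conductorNorm ℤ) K ∧
        ¬ IsSquare ((discr K : ℚ) * -|W.Δ|) ∧ ¬ IsSquare ((discr K : ℚ) * (-(2 * |W.Δ|))) ∧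
        ((Ideal.span {(2 : ℤ)}).primesOver (𝓞 K)).ncard = 2 ∧
        (∀ [Fact ℓ.Prime], ∀ Q : (W.baseChange ℚ_[ℓ]).toAffine.Point, 2 • Q = 0 → Q = 0) ∧
        ∃ (Wd : WeierstrassCurve ℚ) (_ : Wd.IsElliptic) (_ : Wd.IsGloballyMinimal),
          (∃ C : VariableChange ℚ, C • W.quadraticTwist (discr K : ℚ) = Wd) ∧ Nat.card (Wd.selmerGroup 2) = 2 := by
  obtain ⟨ℓ, hb, hℓ, hℓ8, hℓN, hsil⟩ := exists_silent_prime_gt W hΔ hsurj b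
  exact ⟨ℓ, hb, hℓ, hsil, supply_DEF1_posDisc_of_shiftAt W
    (admissibleTwistSelmerShift_habitat_of_parity hPT hEP hKP W hsurj hΔ) h1 hℓ hℓ8 hℓN hsil⟩

/-! ## §66 SUPPLY″ on the whole habitat: g9's statements with `hA` removed -/

/-- **SUPPLY″ for every habitat curve, T-A DISCHARGED** — g9's `supply_DEF1_minimalTwin_of_parity` VERBATIM without the hypothesis
`(hA : AdmissibleTwistSelmerShiftAtTwo)`: for `W/ℚ` globally minimal elliptic with `ρ̄_{W,2}` onto, rank `0`, `#Sel₂(W) ∈ {1, 4}`, and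
`¬ F1Sign2.DescentSignNeg W` whenever `Δ_W > 0` and `#Sel₂(W) = 4`: beyond every bound `b` a prime `ℓ ≡ 7 (mod 8)`, `ℓ ∤ N_W`, with
`K = ℚ(√−ℓ)` carrying EVERY K-clause of crux 22136, `2` split, DEF(W,K) = 1 (root-count currency), and a GLOBALLY MINIMAL twin
`Wd ≅ W^{(−ℓ)}` with `#Sel₂(Wd) = 2`. CONDITIONAL on {PT, Tate χ, Kramer parity} and — only on the row `{Δ > 0, #Sel₂ = 4}` — T-V
`F1Sign2.StrictShaPropagationAtTwo` BY NAME. The twin's analytic rank one is NOT asserted; BSD is not proved by any of this.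
[cite: MazurRubin2010, Thm. 2.7, Prop. 3.3, Cor. 3.4 (i), Prop. 5.3] [cite: Kramer1981, Prop. 6] [cite: GrossLMS1991, §1 (p. 235)] -/
theorem supply_DEF1_minimalTwin_of_parity' (hKP : MazurRubin2010.kramerParity ℚ)
    (hPT : poitouTate_selmerStructure_duality_real ℚ)
    (hEP : ∀ v : IsDedekindDomain.HeightOneSpectrum (𝓞 ℚ), localEulerPoincareCharacteristic (v.adicCompletion ℚ))
    (hV : StrictShaPropagationAtTwo)
    (hsurj : W.HasSurjectiveModNGaloisRep 2) (hr : W.mordellWeilRank = 0)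
    (h14 : Nat.card (W.selmerGroup 2) = 1 ∨ Nat.card (W.selmerGroup 2) = 4)
    (hε : 0 < W.Δ → Nat.card (W.selmerGroup 2) = 4 → ¬ DescentSignNeg W) (b : ℕ) :
    ∃ ℓ : ℕ, b < ℓ ∧ ℓ.Prime ∧ ℓ % 8 = 7 ∧ ¬ ℓ ∣ W.conductorNorm ℤ ∧
      ((W.Δ < 0 ∧ ∃! x : ZMod ℓ, 4 * x ^ 3 + ((integralModelInt W).b₂ : ZMod ℓ) * x ^ 2 +
          2 * ((integralModelInt W).b₄ : ZMod ℓ) * x + ((integralModelInt W).b₆ : ZMod ℓ) = 0) ∨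
        (0 < W.Δ ∧ ∀ x : ZMod ℓ, 4 * x ^ 3 + ((integralModelInt W).b₂ : ZMod ℓ) * x ^ 2 +
          2 * ((integralModelInt W).b₄ : ZMod ℓ) * x + ((integralModelInt W).b₆ : ZMod ℓ) ≠ 0)) ∧
      ∃ (K : Type) (_ : Field K) (_ : NumberField K), IsImaginaryQuadratic K ∧ discr K = -(ℓ : ℤ) ∧ Odd (discr K) ∧
        discr K ≠ -3 ∧ SatisfiesHeegnerHypothesis (W.conductorNorm ℤ) K ∧
        ¬ IsSquare ((discr K : ℚ) * -|W.Δ|) ∧ ¬ IsSquare ((discr K : ℚ) * (-(2 * |W.Δ|))) ∧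
        ((Ideal.span {(2 : ℤ)}).primesOver (𝓞 K)).ncard = 2 ∧
        ∃ (Wd : WeierstrassCurve ℚ) (_ : Wd.IsElliptic) (_ : Wd.IsGloballyMinimal),
          (∃ C : VariableChange ℚ, C • W.quadraticTwist (discr K : ℚ) = Wd) ∧ Nat.card (Wd.selmerGroup 2) = 2 := by
  rcases lt_or_gt_of_ne W.isUnit_Δ.ne_zero with hΔ | hΔ
  · -- `Δ < 0`: prime Heegner fields are transposition fields (DEF = 1 for free)
    rcases h14 with h1 | h4
    · obtain ⟨K, _, _, ℓ, hℓ, hb, hK, hd, hodd, hd3, hH, hsq1, hsq2, h2K, huniq, Wd, _, _, hWd, hSel⟩ :=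
        exists_prime_heegnerField_minimalTwin_of_parity W hPT hEP hKP hsurj hΔ h1 b
      obtain ⟨-, hℓN, -⟩ := prime_discr_facts W hK hodd hH hℓ hd
      have hℓ8 : ℓ % 8 = 7 := by
        have h8 := (Quadratic.ncard_primesOver_two_eq_two_iff hK.1).mp h2K
        rw [hd] at h8
        omega
      exact ⟨ℓ, hb, hℓ, hℓ8, hℓN, Or.inl ⟨hΔ, huniq⟩, K, inferInstance, inferInstance, hK, hd, hodd, hd3, hH, hsq1, hsq2,
        h2K, Wd, inferInstance, inferInstance, hWd, hSel⟩
    · obtain ⟨ℓ, hℓ, hb, hℓ8, hℓ2N, K, _, _, hK, hd, hodd, hd3, hH, hsq1, hsq2, h2K, huniq, Wd, _, _, hWd, hSel⟩ :=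
        supply_DEF1_minimalTwin_rowOne_of_duality W hPT hEP hΔ hsurj h4 b
      have hℓN : ¬ ℓ ∣ W.conductorNorm ℤ := fun h => hℓ2N (Dvd.dvd.mul_left h 2)
      exact ⟨ℓ, hb, hℓ, hℓ8, hℓN, Or.inl ⟨hΔ, huniq⟩, K, inferInstance, inferInstance, hK, hd, hodd, hd3, hH, hsq1, hsq2,
        h2K, Wd, inferInstance, inferInstance, hWd, hSel⟩
  · -- `Δ > 0`: silent prime Heegner fields (DEF = 1); `#Sel₂ = 1` by §65, `#Sel₂ = 4` by the sign `ε(W)` (T-V)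
    rcases h14 with h1 | h4
    · obtain ⟨ℓ, hb, hℓ, hsil, K, _, _, hK, hd, hodd, hd3, hH, hsq1, hsq2, h2K, -, Wd, _, _, hWd, hSel⟩ :=
        supply_DEF1_posDisc_of_parity W hPT hEP hKP hΔ hsurj h1 b
      obtain ⟨-, hℓN, -⟩ := prime_discr_facts W hK hodd hH hℓ hd
      have hℓ8 : ℓ % 8 = 7 := by
        have h8 := (Quadratic.ncard_primesOver_two_eq_two_iff hK.1).mp h2K
        rw [hd] at h8
        omega
      exact ⟨ℓ, hb, hℓ, hℓ8, hℓN, Or.inr ⟨hΔ, hsil⟩, K, inferInstance, inferInstance, hK, hd, hodd, hd3, hH, hsq1, hsq2,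
        h2K, Wd, inferInstance, inferInstance, hWd, hSel⟩
    · obtain ⟨ℓ, hb, hℓ, hsil, K, _, _, hK, hd, hodd, hd3, hH, hsq1, hsq2, h2K, -, Wd, _, _, hWd, hSel⟩ :=
        supply_DEF1_posDisc_rowOne_of_not_descentSignNeg W hV hΔ hsurj hr h4 (hε hΔ h4) b
      obtain ⟨-, hℓN, -⟩ := prime_discr_facts W hK hodd hH hℓ hd
      have hℓ8 : ℓ % 8 = 7 := by
        have h8 := (Quadratic.ncard_primesOver_two_eq_two_iff hK.1).mp h2K
        rw [hd] at h8
        omega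
      exact ⟨ℓ, hb, hℓ, hℓ8, hℓN, Or.inr ⟨hΔ, hsil⟩, K, inferInstance, inferInstance, hK, hd, hodd, hd3, hH, hsq1, hsq2,
        h2K, Wd, inferInstance, inferInstance, hWd, hSel⟩

/-- **The same under the binders of crux 22136** (`r_an(W) = 0` with the Gross–Zagier–Kolyvagin fact
`rank_eq_analyticRank_of_analyticRank_le_one` = item 19921 BY NAME; `ρ_{W,2^n}` onto for every `n ≥ 1`) — g9's
`supply_DEF1_minimalTwin_habitat_of_parity` without `hA`. [cite: MazurRubin2010, Thm. 2.7, Prop. 3.3, Cor. 3.4 (i)] [cite: GrossLMS1991, §1 (p. 235)] -/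
theorem supply_DEF1_minimalTwin_habitat_of_parity' (hKP : MazurRubin2010.kramerParity ℚ)
    (hPT : poitouTate_selmerStructure_duality_real ℚ)
    (hEP : ∀ v : IsDedekindDomain.HeightOneSpectrum (𝓞 ℚ), localEulerPoincareCharacteristic (v.adicCompletion ℚ))
    (hV : StrictShaPropagationAtTwo)
    (hGZK : rank_eq_analyticRank_of_analyticRank_le_one) (hr0 : W.analyticRank = 0)
    (hρ : ∀ n : ℕ, 0 < n → W.HasSurjectiveModNGaloisRep ((2 : ℤ) ^ n))
    (h14 : Nat.card (W.selmerGroup 2) = 1 ∨ Nat.card (W.selmerGroup 2) = 4)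
    (hε : 0 < W.Δ → Nat.card (W.selmerGroup 2) = 4 → ¬ DescentSignNeg W) (b : ℕ) :
    ∃ ℓ : ℕ, b < ℓ ∧ ℓ.Prime ∧ ℓ % 8 = 7 ∧ ¬ ℓ ∣ W.conductorNorm ℤ ∧
      ((W.Δ < 0 ∧ ∃! x : ZMod ℓ, 4 * x ^ 3 + ((integralModelInt W).b₂ : ZMod ℓ) * x ^ 2 +
          2 * ((integralModelInt W).b₄ : ZMod ℓ) * x + ((integralModelInt W).b₆ : ZMod ℓ) = 0) ∨
        (0 < W.Δ ∧ ∀ x : ZMod ℓ, 4 * x ^ 3 + ((integralModelInt W).b₂ : ZMod ℓ) * x ^ 2 +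
          2 * ((integralModelInt W).b₄ : ZMod ℓ) * x + ((integralModelInt W).b₆ : ZMod ℓ) ≠ 0)) ∧
      ∃ (K : Type) (_ : Field K) (_ : NumberField K), IsImaginaryQuadratic K ∧ discr K = -(ℓ : ℤ) ∧ Odd (discr K) ∧
        discr K ≠ -3 ∧ SatisfiesHeegnerHypothesis (W.conductorNorm ℤ) K ∧
        ¬ IsSquare ((discr K : ℚ) * -|W.Δ|) ∧ ¬ IsSquare ((discr K : ℚ) * (-(2 * |W.Δ|))) ∧
        ((Ideal.span {(2 : ℤ)}).primesOver (𝓞 K)).ncard = 2 ∧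
        ∃ (Wd : WeierstrassCurve ℚ) (_ : Wd.IsElliptic) (_ : Wd.IsGloballyMinimal),
          (∃ C : VariableChange ℚ, C • W.quadraticTwist (discr K : ℚ) = Wd) ∧ Nat.card (Wd.selmerGroup 2) = 2 := by
  have hr : W.mordellWeilRank = 0 := by rw [(hGZK W (by rw [hr0]; exact zero_le_one)).1, hr0]
  exact supply_DEF1_minimalTwin_of_parity' W hKP hPT hEP hV (by simpa using hρ 1 one_pos) hr h14 hε b

end Summit.BirchSwinnertonDyer.BirchSwinnertonDyer.Theorems.GenusKolyTwin

end
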